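import Summits.ResolutionOfSingularities.ResolutionOfSingularities.Theorems.FrobeniusClosingSteerWords31BGeomRecut
import Summits.ResolutionOfSingularities.ResolutionOfSingularities.Theorems.FrobeniusClosingSteerGeoDictGeomDatum
import Summits.ResolutionOfSingularities.ResolutionOfSingularities.Theorems.FrobeniusClosingSteerGeomChartResidueImperfect
import Summits.ResolutionOfSingularities.ResolutionOfSingularities.Theorems.FrobeniusClosingSteerStrippedThreadInfinitelyHitHG

/-!
# Crux `Steer` (stmt-ResolutionOfSingularities-16345), line `switching-dichotomy` — WORDS 32: §σ2.30 (2) res-D-pv-003's F-A3-HG leaf, §σ2.30 (4) the hNS RE-GLUE / K4♯ companion split words, §σ2.30 (5) hKr BY NAME (HOIST of the registered skeleton r52 5a09c4c2f84a0135, l.2680–2825,2826–2917,2918–2924, inside `section HeightSplitTwo` with its `variable {K : Type} [Field K]`)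

Holder res-L0-w41-lead-1 g6 on res-L0-w41-plan-1 RULING 47 (E1) / 104b; see `…Words01Core` for the hoist protocol (bodies byte for byte;
`[cite: …]` / `[folklore]` tags on CLOSED `def … : Prop` words are written «(ref. …)» / «(folklore)» — GATE NOTE of `…Words02Stubs`;
cite keys inside `[cite:]` tags normalised to `references.bib` keys where needed, as in `…Words03Phases`).
Nothing here is a statement of the manuscript [claim: Hironaka2017, status: under-review]. OURS (candidates / vocabulary; AI review is
weaker than expert review).
-/

open Summit.ResolutionOfSingularities.ResolutionOfSingularities.Theses.FrobeniusClosing (IsolatedForcedTermination)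
open Literature.AlgebraicGeometry.Resolution (IsAbhyankarPlace FGOver exists_ringKrullDim_eq_and_trdeg_eq
  trdeg_eq_trdeg_of_isFractionRing locAtCentre IsQuadraticTransformAlong SubringDominates IsRsopPart
  LocalUniformization3 RelLocalUniformization CossartPiltant2019General)
open Summit.ResolutionOfSingularities.ResolutionOfSingularities.Theorems.SteerRankThinness
  (HasProperCoarsening concl_of_hasProperCoarsening rankOne_of_not_hasProperCoarsening)
open Summit.ResolutionOfSingularities.ResolutionOfSingularities.Theorems.PfaffLine

set_option linter.dupNamespace false

namespace Summit.ResolutionOfSingularities.ResolutionOfSingularities.Theorems.SwitchingDichotomy.Words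

section SteeredTwo

open IsLocalRing
open Literature.AlgebraicGeometry.Resolution (IsLocalBlowupAlong IsQuadraticTransform IsExcellentRing)

variable {K : Type} [Field K]


/-! ##### §σ2.30 (2) — res-D-pv-003's LEAF (file `../../res-D-pv-003/W41-FA3HG-leaf.r43.delta.lean` sha16 a76d4998755df32e; COHFIX ADAPTER substituted for its last line by strat-2, see the comment in place) -/

/-- **F-A3 in the GEOMETRIC currency · `StrippedThreadTwoNHG` HOLDS modulo (L7)** (res-L0-w41-plan-1 RULING 152a; res-D-pv-003's engine
`StrippedThread.exists_not_noEternalStrippedChainHG_of_infinitelyHit` (…StrippedThreadInfinitelyHitHG) = the Θ1♭ engine with the geometric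
datum of its codimension-one members discharged by `GeoDict.exists_geomDatum_of_locChar_coheight_one` (…GeoDictGeomDatum) over the tower model
(`SteeredExit.exists_model_of_tower`, `TailCodim.ringKrullDim_eq_of_model`); the rest is `strippedThreadTwoNH_of_L7` VERBATIM). OURS. -/
theorem strippedThreadTwoNHG_of_L7
    (hL7 : ∀ {k K : Type} [Field k] [Field K] [Algebra k K] (p : ℕ) [Fact p.Prime] [CharP k p] [PerfectField k]
      (S : Subring K) [IsRegularLocalRing S] [Algebra k S],
      (∀ c : k, ((algebraMap k S c : S) : K) = algebraMap k K c) → Algebra.EssFiniteType k S →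
      ∀ f g : S, HasCleaningDerivations p S f g) :
    StrippedThreadTwoNHG := by
  intro p hp2 k K _ _ _ _ _ O A₀ h₀ t core _ R P s hR0 _ hrun _ _ J hJ hJA hJ2 hfin2 hinf
  subst hp2
  haveI : Fact (Nat.Prime 2) := ⟨Nat.prime_two⟩
  haveI : CharP K 2 := charP_of_injective_algebraMap (algebraMap k K).injective 2
  obtain ⟨hfg, htp, hfr, hreg, -, hzd, -, -, -, -, -, -, htr, -⟩ := core
  have hmono : Monotone R := hrun.monotone
  obtain ⟨-, hstep⟩ := hrun
  have hsp : ∀ i, s i ^ 2 ∈ R i := fun i => by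
    obtain ⟨_, hs, -⟩ := hstep i
    exact hs
  have hbl : ∀ i, IsLocalBlowupAlong O (R i) (P i) (R (i + 1)) := fun i => by
    obtain ⟨_, _, -, hbl, -⟩ := hstep i
    exact hbl
  have h0 : IsRegularLocalRing (R 0) := by
    rw [hR0]
    exact (Literature.AlgebraicGeometry.Resolution.isRegularLocalRing_locAtCentre_iff h₀).mpr hreg
  have hregR : ∀ i, IsRegularLocalRing (R i) := fun i =>
    _root_.Summit.ResolutionOfSingularities.ResolutionOfSingularities.Theorems.SwitchingDichotomy.SteeredMembersRegular.isRegularLocalRing_steps (O := O) R P i h0 (fun j _ => by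
      obtain ⟨hloc, hs, hσ, hblj, -⟩ := hstep j
      refine ⟨hloc, ?_, hblj⟩
      rcases hσ with hperm | ⟨hP, -, -⟩
      · exact Or.inl hperm.2.2.1
      · exact Or.inr hP) i le_rfl
  have hdim : ∀ i, ringKrullDim (R i) = (4 : ℕ) := fun i =>
    _root_.Summit.ResolutionOfSingularities.ResolutionOfSingularities.Theorems.SwitchingDichotomy.TailCodim.ringKrullDim_member_eq
      k K O A₀ h₀ t two_pos hfg htp hfr hzd htr R i hR0 fun j _ => (hbl j).isLocalBlowup
  have hheight : ∀ (i m : ℕ) (hle : R i ≤ R m) (Q : Ideal (R m)) [Q.IsPrime],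
      Q.height ≤ (Q.comap (Subring.inclusion hle)).height := by
    intro i m hle Q _
    by_cases him : i ≤ m
    · exact _root_.Summit.ResolutionOfSingularities.ResolutionOfSingularities.Theorems.SwitchingDichotomy.TowerHeight.height_le_height_comap_of_tower
        O A₀ h₀ hfg t 2 two_pos htp hfr R hR0 (fun j => (hbl j).isLocalBlowup) him hle Q
    · have e : R i = R m := le_antisymm hle (hmono (le_of_not_ge him))
      have key : ∀ (A B : Subring K) (_ : A = B) (h : A ≤ B) (Q : Ideal B) [Q.IsPrime],
          Q.height ≤ (Q.comap (Subring.inclusion h)).height := by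
        intro A B e h Q _
        subst e
        have hQ : Q.comap (Subring.inclusion h) = Q := by
          ext y
          rw [Ideal.mem_comap]
          rfl
        rw [hQ]
      exact key _ _ e hle Q
  have hvis : ∀ i, (∃ _ : IsLocalRing (R i), P i ≠ maximalIdeal (R i)) →
      (P i).IsPrime ∧ (∃ g : R i, (⟨s i ^ 2, hsp i⟩ : R i) - g ^ 2 ∈ P i ^ 2) ∧
      (∀ (Q : Ideal (R i)) [Q.IsPrime], Q < P i →
        IsRegularLocalRing (AdjoinRoot ((Polynomial.X : Polynomial (Localization.AtPrime Q)) ^ 2 -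
          Polynomial.C (algebraMap (R i) (Localization.AtPrime Q) ⟨s i ^ 2, hsp i⟩)))) ∧
      (∀ _ : (P i).IsPrime, ¬ IsRegularLocalRing (AdjoinRoot ((Polynomial.X : Polynomial (Localization.AtPrime (P i))) ^ 2 -
          Polynomial.C (algebraMap (R i) (Localization.AtPrime (P i)) ⟨s i ^ 2, hsp i⟩)))) ∧
      IsRegularLocalRing (R i ⧸ P i) := by
    intro i ⟨_, hne⟩
    obtain ⟨hloc, hs, hσ, -, -⟩ := hstep i
    have hperm : IsPermissibleCentre (R i) 2 ⟨s i ^ 2, hsp i⟩ (P i) := by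
      rcases hσ with hperm | ⟨hP, -, -⟩
      · exact hperm
      · exact absurd hP hne
    obtain ⟨hPi, hsing, hmc, -⟩ := hperm.2.1
    refine ⟨hPi, hperm.2.2.2, fun Q hQp hQ => ?_, fun _ => hsing, hperm.2.2.1⟩
    by_contra hnr
    exact hQ.ne (hmc Q hnr hQ.le)
  have hinf' : ∀ m₀ : ℕ, ∃ m, m₀ ≤ m ∧ m ∉ J ∧ ∃ l ∈ J, IsHitStep R P m l := by
    intro m₀
    by_contra h
    apply hinf
    exact ⟨m₀, fun m hm hmJ l hl hhit => h ⟨m, hm, hmJ, l, hl, hhit⟩⟩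
  -- ### the germ-level H from (L7): a local ring `(R i)_Q ⊆ K` is a localisation of the finitely generated model, hence e.f.t. over `k`
  have hH : ∀ (i : ℕ) (Q : Ideal (R i)) [Q.IsPrime] (S : Subring K) [IsLocalRing S],
      (∀ z : K, z ∈ S ↔ ∃ a b : R i, b ∉ Q ∧ z = (a : K) / b) → ∀ f g : S,
      (∀ N : ℕ, (∀ h : S, f - h ^ 2 ∉ IsLocalRing.maximalIdeal S ^ (N + 1)) → f - g ^ 2 ∈ IsLocalRing.maximalIdeal S ^ N →
        ∃ D : Derivation ℤ S S, D f ∉ IsLocalRing.maximalIdeal S ^ N ∨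
          ((∀ y ∈ IsLocalRing.maximalIdeal S, D y ∈ IsLocalRing.maximalIdeal S) ∧ D f ∉ IsLocalRing.maximalIdeal S ^ (N + 1))) := by
    intro i Q _ S _ hS f g
    obtain ⟨A₁, -, -, hfg₁, hRA₁⟩ :=
      _root_.Summit.ResolutionOfSingularities.ResolutionOfSingularities.Theorems.SwitchingDichotomy.SteeredExit.exists_model_of_tower
        O A₀ h₀ hfg hR0 (N := i) fun l _ => (hbl l).isLocalBlowup
    haveI := hregR i
    haveI : IsRegularLocalRing S :=
      _root_.Summit.ResolutionOfSingularities.ResolutionOfSingularities.Theorems.SwitchingDichotomy.GeoDict.isRegularLocalRing_of_locChar hS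
    letI : Algebra k S := ((algebraMap k K).codRestrict S
      (_root_.Summit.ResolutionOfSingularities.ResolutionOfSingularities.Theorems.SwitchingDichotomy.GeoDict.algebraMap_mem_of_locChar
        O A₁ hRA₁ hS)).toAlgebra
    have hcompat : ∀ c : k, ((algebraMap k S c : S) : K) = algebraMap k K c := fun c => rfl
    have hEFT : Algebra.EssFiniteType k S :=
      _root_.Summit.ResolutionOfSingularities.ResolutionOfSingularities.Theorems.SwitchingDichotomy.GeoDict.essFiniteType_of_locChar
        O A₁ hRA₁ hS hfg₁ hcompat
    exact hL7 2 S hcompat hEFT f g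
  -- ### the geometric datum of every codimension-one chain ring (RULING 152a): chart of the tower model at a non-maximal prime, coheight 1
  have hgeom : ∀ (i : ℕ) (Q : Ideal (R i)) [Q.IsPrime], (∃ _ : IsLocalRing (R i), Q ≠ IsLocalRing.maximalIdeal (R i)) →
      Q.height + 1 = ((4 : ℕ) : ℕ∞) → ∀ (T : Subring K), (∀ z : K, z ∈ T ↔ ∃ a b : R i, b ∉ Q ∧ z = (a : K) / b) →
      ∃ (A : Subalgebra k K) (Q' : Ideal A), A.FG ∧ Q'.IsPrime ∧ (∃ Q'' : Ideal A, Q''.IsPrime ∧ Q' < Q'') ∧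
        ringKrullDim (A ⧸ Q') = 1 ∧ ∀ z : K, z ∈ T ↔ ∃ a b : A, b ∉ Q' ∧ z = (a : K) / (b : K) := by
    intro i Q _ hQne hht T hT
    obtain ⟨_, hQne⟩ := hQne
    obtain ⟨A₁, -, h01, hfg₁, hRA₁⟩ :=
      _root_.Summit.ResolutionOfSingularities.ResolutionOfSingularities.Theorems.SwitchingDichotomy.SteeredExit.exists_model_of_tower
        O A₀ h₀ hfg hR0 (N := i) fun l _ => (hbl l).isLocalBlowup
    have hn : ringKrullDim A₁ = ((4 : ℕ) : WithBot ℕ∞) :=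
      _root_.Summit.ResolutionOfSingularities.ResolutionOfSingularities.Theorems.SwitchingDichotomy.TailCodim.ringKrullDim_eq_of_model
        A₀ A₁ h01 two_pos htp hfr hfg₁ htr
    obtain ⟨c', hc'⟩ := ENat.ne_top_iff_exists.mp (Q.height_ne_top Ideal.IsPrime.ne_top')
    have hc4 : c' + 1 = 4 := by
      rw [← hc'] at hht
      exact_mod_cast hht
    obtain ⟨Q', h1, h2, h3, h4⟩ :=
      _root_.Summit.ResolutionOfSingularities.ResolutionOfSingularities.Theorems.SwitchingDichotomy.GeoDict.exists_geomDatum_of_locChar_coheight_one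
        O A₁ hRA₁ hT hfg₁ hQne hn hc'.symm hc4
    exact ⟨A₁, Q', hfg₁, h1, h2, h3, h4⟩
  obtain ⟨c, hc2, hcn, -, hK, hKG⟩ :=
    _root_.Summit.ResolutionOfSingularities.ResolutionOfSingularities.Theorems.SwitchingDichotomy.StrippedThread.exists_not_noEternalStrippedChainHG_of_infinitelyHit
      2 O A₀ h₀ hfg R P s 4 hR0 hbl (fun i => by obtain ⟨_, _, -, -, hst⟩ := hstep i; exact hst) hsp hregR hdim
      hheight hvis (IsPosStep R P) (fun _ => Iff.rfl) (IsAncestorStep R P) (fun _ _ => Iff.rfl) J hJ hJA hJ2 hfin2 hinf'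
      (fun S S' _ _ hle hqt ξ hξ hspan f G F hf hG hF e he hlaw =>
        _root_.Summit.ResolutionOfSingularities.ResolutionOfSingularities.Theorems.SwitchingDichotomy.CleanerDescent.cleaner_descent
          2 hle hqt hξ hspan hf hG hF he hlaw)
      (fun i Q _ S _ hS f g => hH i Q S hS f g) hgeom
  interval_cases c
  · exact Or.inl hK
  · -- COHFIX ADAPTER (plan-1 RULING 160b (1)): the engine's K♭HG body carries the coheight-one clause `ringKrullDim (A ⧸ Q) = 1`,
    -- r43's (W4) `NoEternalStrippedRadicandChainHG` (cohfix, RULING 159) does not — forget it.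
    exact Or.inr fun h => hKG rfl fun k' L _ _ _ _ _ S _ hle f g x e he hinf hgm =>
      h k' L S hle f g x e he hinf fun m => by
        obtain ⟨A, Q, hA, hQ, hQ', -, hS⟩ := hgm m
        exact ⟨A, Q, hA, hQ, hQ', hS⟩


/-- **F-A3-geom · `StrippedThreadTwoNHG` HOLDS — hA3 (§σ2.29) CLOSED IN THE KERNEL**: `strippedThreadTwoNHG_of_L7` fed with res-D-pv-004's (L7)
`MemberDerivations.hasCleaningDerivations_of_essFiniteType_perfect` (as `strippedThreadTwoNH_holds`). OURS. -/
theorem strippedThreadTwoNHG_holds : StrippedThreadTwoNHG :=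
  strippedThreadTwoNHG_of_L7 (fun p _ _ _ S _ _ hc hE f g => by
    haveI := hE
    exact _root_.Summit.ResolutionOfSingularities.ResolutionOfSingularities.Theorems.SwitchingDichotomy.MemberDerivations.hasCleaningDerivations_of_essFiniteType_perfect
      p S hc f g)


/-! ##### §σ2.30 (4) — hNS RE-GLUE: the K4♯ companion split (res-L0-w41-strat-2 g3 words; plan-1 RULING 160b (4)) -/

/-- **(h0) glue PROVED: (Par-S) ⟸ hARᵒ ∧ hK4♯ ∧ hEv** — `strippingTailSwitchingConclTwoN_of_parity'` with the refuted hNS GONE and K4♯ STRONG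
(r40's `…_of_parity` minus its idle first binder), by excluded middle on «odd cleaned-order point steps i.o.». Pure logic. OURS. [folklore] -/
theorem strippingTailSwitchingConclTwoN_of_parityK (hARo : StrippingTailSwitchingOddArithTwoN)
    (hK4 : StrippingTailSwitchingArithConclTwoN) (hEv : StrippingTailSwitchingEvenConclTwoN) : StrippingTailSwitchingConclTwoN := by
  intro p hp2 k K _ _ _ _ _ O A₀ h₀ t core hrk R P s hR0 hN hrun hnd hhigh h2 hinf hwild hsw
  by_cases hodd : ∀ i₀ : ℕ, ∃ i, i₀ ≤ i ∧ OddCleanedPointStepAt R P s p i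
  · exact hK4 p hp2 k K O A₀ h₀ t core hrk R P s hR0 hN hrun hnd hhigh h2 hinf hwild hsw
      (hARo p hp2 k K O A₀ h₀ t core hrk R P s hR0 hN hrun hnd hhigh h2 hinf hwild hsw hodd)
  · push Not at hodd
    obtain ⟨i₀, hi₀⟩ := hodd
    exact hEv p hp2 k K O A₀ h₀ t core hrk R P s hR0 hN hrun hnd hhigh h2 hinf hwild hsw ⟨i₀, hi₀⟩

/-- **(h1) hK4ⁿᶜ · StrippingTailSwitchingArithNoCompanionConclTwoN** (WORK-MODULO the β-leaf = the NO-COMPANION sub-case of K4♯, plan-1 RULING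
160b (4): «odd tails with NO companion singular surface at all but finitely many visited A-stages ⇒ `Concl`»; res-L0-w41-idea-1's v18 leaf
`hK4_of_betaHat … : hNS → K4♯` re-keys to this word (v18.1) by turning its one instantiation of hNS at the run into the case binder; K-β4
`LegalityDebt` consumes the case hypothesis where it consumed hNS; K-β0 … K-β7 owners unchanged): K4♯'s binders VERBATIM + the CASE HYPOTHESIS
= hNS's conclusion VERBATIM («eventually, at every odd-cleaned-order point step, no singular surface through the centre») ⇒ `Concl`. Why it might
fail: as K4♯ — a perfect non-closed `k` re-creating a rootless odd binary residue forever (tri-1 bench b4) — minus the companion mechanism.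
OURS. (folklore) -/
def StrippingTailSwitchingArithNoCompanionConclTwoN : Prop :=
  ∀ p : ℕ, p = 2 →
    ∀ (k K : Type) [Field k] [CharP k p] [PerfectField k] [Field K] [Algebra k K]
    (O : ValuationSubring K) (A₀ : Subalgebra k K) (h₀ : A₀.toSubring ≤ O.toSubring) (t : K),
    CoreDatum p 4 k K O A₀ h₀ t → ¬ HasProperCoarsening O →
    ∀ (R : ℕ → Subring K) (P : (i : ℕ) → Ideal (R i)) (s : ℕ → K),
      R 0 = locAtCentre A₀.toSubring O → NormalAt O (R 0) p t → IsSteeredRun O R P t p s →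
      (¬ ∃ i₀ c : ℕ, 1 ≤ c ∧ IsDominantTail R P i₀ c) →
      (∃ i₀ : ℕ, ∀ i, i₀ ≤ i → IsHighOrderAt R s p i) →
      ¬ HeightTwoStepsInfinite R P → {j | IsPosStep R P j}.Infinite →
      (∀ i₀ : ℕ, ∃ i, i₀ ≤ i ∧ IsPointStep R P i ∧
        ∀ hs : s i ^ p ∈ R i, ¬ HasIsolatedSingularity (RadicandRing (R i) p ⟨s i ^ p, hs⟩)) →
      (¬ ∃ i₀ : ℕ, ∃ x : K, x ≠ 0 ∧ x ∈ O ∧ O.valuation x < 1 ∧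
        ∀ i, i₀ ≤ i → ∀ y ∈ R i, O.valuation y < 1 → ∃ j, i < j ∧ y / x ∈ R j) →
      ArithSwitchClause R P s p →
      (∃ i₀ : ℕ, ∀ i, i₀ ≤ i → OddCleanedPointStepAt R P s p i → NoSingularSurfaceAt R s p i) →
      Concl O A₀ t

/-- **(h2) hK4ᶜ · StrippingTailSwitchingArithCompanionConclTwoN** (FRONTIER, OPEN = the COMPANION sub-case of K4♯, plan-1 RULINGS 160b (4) /
159a / 160e: «odd tails with a companion singular surface at INFINITELY MANY visited A-stages ⇒ `Concl`»; BENCH = res-L0-w41-strat-1's M (eternal,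
σ_top-legal, companion `W = V(u, η)` non-regular at every A-stage, `d = 5`, `F₅` irreducible over `𝔽₂`; `Concl(M)` ✓ by the closed-form chart
`T′² = x₃·G`, SHARP-GAME-M 663a9f36e2bfa179); first line = strat-1's hNS♯ (finitely many equi-ordered regular centres inside `Sing(W)` make the
companion's strict transform regular, hence σ_top-permissible: a CJS-type transfer, σ_top♯ as a PROOF DEVICE — the run of record is NOT amended),
priced by strat-1's M♭ (160e)): K4♯'s binders VERBATIM + the negation of (h1)'s case hypothesis ⇒ `Concl`. Why it might fail: `Concl` must come
WITHOUT σ_top termination; a companion run at a genuine defect place over a non-closed perfect `k` has no mechanism on record (dimension-4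
hypersurface, characteristic 2). OURS. (folklore) -/
def StrippingTailSwitchingArithCompanionConclTwoN : Prop :=
  ∀ p : ℕ, p = 2 →
    ∀ (k K : Type) [Field k] [CharP k p] [PerfectField k] [Field K] [Algebra k K]
    (O : ValuationSubring K) (A₀ : Subalgebra k K) (h₀ : A₀.toSubring ≤ O.toSubring) (t : K),
    CoreDatum p 4 k K O A₀ h₀ t → ¬ HasProperCoarsening O →
    ∀ (R : ℕ → Subring K) (P : (i : ℕ) → Ideal (R i)) (s : ℕ → K),
      R 0 = locAtCentre A₀.toSubring O → NormalAt O (R 0) p t → IsSteeredRun O R P t p s →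
      (¬ ∃ i₀ c : ℕ, 1 ≤ c ∧ IsDominantTail R P i₀ c) →
      (∃ i₀ : ℕ, ∀ i, i₀ ≤ i → IsHighOrderAt R s p i) →
      ¬ HeightTwoStepsInfinite R P → {j | IsPosStep R P j}.Infinite →
      (∀ i₀ : ℕ, ∃ i, i₀ ≤ i ∧ IsPointStep R P i ∧
        ∀ hs : s i ^ p ∈ R i, ¬ HasIsolatedSingularity (RadicandRing (R i) p ⟨s i ^ p, hs⟩)) →
      (¬ ∃ i₀ : ℕ, ∃ x : K, x ≠ 0 ∧ x ∈ O ∧ O.valuation x < 1 ∧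
        ∀ i, i₀ ≤ i → ∀ y ∈ R i, O.valuation y < 1 → ∃ j, i < j ∧ y / x ∈ R j) →
      ArithSwitchClause R P s p →
      (∀ i₀ : ℕ, ∃ i, i₀ ≤ i ∧ OddCleanedPointStepAt R P s p i ∧ ¬ NoSingularSurfaceAt R s p i) →
      Concl O A₀ t

/-- **(h3) glue PROVED: K4♯ ⟸ hK4ⁿᶜ ∧ hK4ᶜ** (the per-tail dichotomy eventually-none / infinitely-often, excluded middle). Pure logic. OURS. [folklore] -/
theorem strippingTailSwitchingArithConclTwoN_of_companionSplit (hnc : StrippingTailSwitchingArithNoCompanionConclTwoN)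
    (hc : StrippingTailSwitchingArithCompanionConclTwoN) : StrippingTailSwitchingArithConclTwoN := by
  intro p hp2 k K _ _ _ _ _ O A₀ h₀ t core hrk R P s hR0 hN hrun hnd hhigh h2 hinf hwild hsw harith
  by_cases hev : ∃ i₀ : ℕ, ∀ i, i₀ ≤ i → OddCleanedPointStepAt R P s p i → NoSingularSurfaceAt R s p i
  · exact hnc p hp2 k K O A₀ h₀ t core hrk R P s hR0 hN hrun hnd hhigh h2 hinf hwild hsw harith hev
  · push Not at hev
    exact hc p hp2 k K O A₀ h₀ t core hrk R P s hR0 hN hrun hnd hhigh h2 hinf hwild hsw harith hev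

/-- (h4a) hK4ⁿᶜ ⟸ K4♯ (monotone). Pure logic. OURS. [folklore] -/
theorem strippingTailSwitchingArithNoCompanionConclTwoN_of_arithConcl (hK4 : StrippingTailSwitchingArithConclTwoN) :
    StrippingTailSwitchingArithNoCompanionConclTwoN :=
  fun p hp2 k K _ _ _ _ _ O A₀ h₀ t core hrk R P s hR0 hN hrun hnd hhigh h2 hinf hwild hsw harith _ => hK4 p hp2 k K O A₀ h₀ t core hrk R P s hR0 hN hrun hnd hhigh h2 hinf hwild hsw harith

/-- (h4b) hK4ᶜ ⟸ K4♯ (monotone). Pure logic. OURS. [folklore] -/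
theorem strippingTailSwitchingArithCompanionConclTwoN_of_arithConcl (hK4 : StrippingTailSwitchingArithConclTwoN) :
    StrippingTailSwitchingArithCompanionConclTwoN :=
  fun p hp2 k K _ _ _ _ _ O A₀ h₀ t core hrk R P s hR0 hN hrun hnd hhigh h2 hinf hwild hsw harith _ => hK4 p hp2 k K O A₀ h₀ t core hrk R P s hR0 hN hrun hnd hhigh h2 hinf hwild hsw harith

/-- (h4c) **the old currency from the new**: `hK4′ : hNS → K4♯` ⟸ hK4ⁿᶜ (instantiate hNS at the run) — slate13's `hK4′` is fed by the β-leaf's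
re-keyed target, so nothing of record is lost. Pure logic. OURS. [folklore] -/
theorem hK4'_of_noCompanionConcl (hnc : StrippingTailSwitchingArithNoCompanionConclTwoN) :
    NoCompanionSingularSurfaceTwoN → StrippingTailSwitchingArithConclTwoN :=
  fun hNS p hp2 k K _ _ _ _ _ O A₀ h₀ t core hrk R P s hR0 hN hrun hnd hhigh h2 hinf hwild hsw harith =>
    hnc p hp2 k K O A₀ h₀ t core hrk R P s hR0 hN hrun hnd hhigh h2 hinf hwild hsw harith
      (hNS p hp2 k K O A₀ h₀ t core hrk R P s hR0 hN hrun hnd hhigh h2 hinf hwild hsw)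


/-! ##### §σ2.30 (5) — hKr BY NAME (res-L0-w41-stub-3's rider, plan-1 RULING 160b (5)) -/

/-- **(h5) hKr BY NAME** — (W3) `GeomChartResidueImperfect 2` from res-L0-w41-stub-3's tree theorem `GeomChain.geomChartResidueImperfect_holds`
(`…Theorems.FrobeniusClosingSteerGeomChartResidueImperfect`, p538090 ✓: the (W3) body with `IsGeomChart` unfolded). OURS. [folklore] -/
theorem geomChartResidueImperfect_two : GeomChartResidueImperfect 2 :=
  _root_.Summit.ResolutionOfSingularities.ResolutionOfSingularities.Theorems.SwitchingDichotomy.GeomChain.geomChartResidueImperfect_holds 2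


end SteeredTwo

end Summit.ResolutionOfSingularities.ResolutionOfSingularities.Theorems.SwitchingDichotomy.Words
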